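import Literature.AlgebraicGeometry.Resolution.PointBlowupDirectrixRank
import HarnessLib

/-!
# [OURS · L1 W4.6] Rung (iii) "Moh window" for the classical pair (order, shade): inside the window
  `p ≤ ord₀ F < 2p` a point blow-up of `x^p + F(y)` never increases the shade at an equimultiple
  point — every dimension, every field of characteristic `p`

Cell `res-hironaka`, rung L, slot W4.6 (restricted regimes as rungs), seat `res-L1-s46-pv-6` ("(iii)
second prover … via the kangaroo atlas certificates — finite certificate first, then the general
statement").  This file is the GENERAL STATEMENT; `MarkedTransferCampaignW46MohWindowShadeCert.lean` is
the `decide`-checked companion over `Literature.AlgebraicGeometry.Resolution.KangarooAtlasCert`.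
OURS: a theorem about the classical characteristic-`p` model of [Hauser2010, §§F–G] as typed in the tree
(`PointBlowup.State/step/shade/IsEquimultiplePoint/ShadeIncreases`, `PointBlowupShade.lean`), replacing —
for regime (iii) of the cell's RESCUE-SEED row W4.6, "purely inseparable `z^p = f`, `ord f < 2p` (Moh
window)" — the ROLE that Th. 16.6 (2) / Eq. (127) (ms. p. 84 l. 10–20) plays for the typed résumé string,
by the behaviour of Hauser's shade.  NOT a statement of the manuscript [claim: Hironaka2017, status:
under-review]; nothing of it is used or asserted.  AI review is weaker than expert review.

## What is proved (prime `p`, field `K` of char. `p`, finite `σ`, state `s = (F, r)` with `F` cleaned of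
## `p`-th power monomials, `y^r ∣ F`, `o = ord₀ F`, point `b` of the `y_j`-chart with `b_j = 0`)

* `not_shadeIncreases_of_lt_two_mul` / `shade_step_le_of_lt_two_mul` / `shade_step_le_of_window`:
  `p ≤ o < 2p` and `IsEquimultiplePoint p j b s` ⟹ `¬ ShadeIncreases p j b s` (`shade' ≤ shade`).
* `no_lost_component_of_ordZero_eq`: at `o = p` an equimultiple point loses no exceptional component of
  positive multiplicity (`r_j = 0`, `b_i ≠ 0 → r_i = 0`); whence `shadeStalls_of_ordZero_eq`: at `o = p`
  the shade is FROZEN (with the tree's [CJS 2020] Thm. 3.10 (4) in the model) — inside the window the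
  shade moves only at steps with `p < o < 2p`, and only down.
* `shade_antitone_along_of_window`: along equimultiple point blow-ups staying in the window the shade is
  non-increasing.

## Proof
`p ∤ o`: no increase at ANY point (tree `PointBlowup.shade_step_le_of_not_dvd`, Hauser's condition (1)).
`p ∣ o`: then `o = p`; an increase would lose an exceptional component `{y_i = 0}`, `i ≠ j`, `r_i ≥ 1`,
`b_i ≠ 0` (tree `PointBlowup.necessary_of_shadeIncreases` (iii)), so `y_i ∣ F_p`; near ⟹ ridge (tree
`PointBlowup.nearOnDirectrixAt`, [CossartJannsenSaito2020, Thm. 3.14] in the model) makes `F_p` additive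
along `v = e_j + Σ b_i e_i`, so the polar `Σ_k v_k ∂_k F_p` vanishes (`PointBlowup.mem_additiveSubspace_iff`);
read it at `y^{d₀ − e_i}` for a monomial `y^{d₀}` of `F_p` of LEAST `y_i`-exponent `m ≥ 1`: only `∂_i`
contributes, coefficient `v_i · m · c_{d₀}`, so `p ∣ m`, `d₀ = p·e_i` — excluded by the cleaning.
Barriers (`Literature/Barriers/ResolutionOfSingularities/`): `ResidualOrderUnboundedNarrow.
mohStability_fails_for_each_e` is about `z^{p^e} + F`, `e ≥ 3` — this rung is `e = 1` (tree
`PointBlowup.shade_le_shade_add_one_along`: `+1` at most; here: the `+1` needs `ord₀ F ≥ 2p`);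
`KangarooShadeIncrease.Hauser2003_kangarooShadeIncrease` has `ord₀ F = 8 ≥ 2p` at the antelope.
-/

noncomputable section

set_option linter.dupNamespace false -- mandated namespace of this single-conjunct summit

open MvPolynomial Finset

open scoped BigOperators

namespace Summit.ResolutionOfSingularities.ResolutionOfSingularities.Theorems.CampaignW46.MohWindowShade

open Literature.AlgebraicGeometry.Resolution
open Literature.AlgebraicGeometry.Resolution.PointBlowup
open Literature.AlgebraicGeometry.Resolution.Hauser2010
open Literature.AlgebraicGeometry.Resolution.HauserPerlega2019 (initialForm)

variable {σ : Type*} {K : Type*} [Field K] [Fintype σ] [DecidableEq σ] [DecidableEq K]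
variable (p : ℕ) [hp : Fact p.Prime] [CharP K p]

/-! ## 1. The polar argument -/

omit [DecidableEq K] hp in
/-- **[OURS · L1 W4.6] Polar read at a monomial of least `y_k`-exponent.**  If `Σ_i v_i ∂_i Φ = 0`,
`v_k ≠ 0`, and `y^{d₀}` is a monomial of `Φ` whose `y_k`-exponent `d₀ k ≥ 1` is least among the
monomials of `Φ`, then `p ∣ d₀ k`: the coefficient of `y^{d₀ − e_k}` in the polar is
`v_k · (d₀ k) · c_{d₀}`.  NOT a statement of the manuscript. [folklore] -/
theorem dvd_apply_of_polar_eq_zero {Φ : MvPolynomial σ K} {v : σ → K} {k : σ}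
    (hvk : v k ≠ 0) (hpolar : ∑ i, v i • pderiv i Φ = 0) {d₀ : σ →₀ ℕ} (hd₀ : d₀ ∈ Φ.support)
    (hmin : ∀ d ∈ Φ.support, d₀ k ≤ d k) (hpos : 1 ≤ d₀ k) : p ∣ d₀ k := by
  classical
  set γ : σ →₀ ℕ := d₀ - Finsupp.single k 1 with hγ
  have hγk : γ + Finsupp.single k 1 = d₀ := by
    rw [hγ]
    exact tsub_add_cancel_of_le (Finsupp.single_le_iff.mpr (by simpa using hpos))
  have hγapp : γ k + 1 = d₀ k := by
    have := congrArg (fun f => f k) hγk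
    simpa using this
  have hcoeff := congrArg (coeff γ) hpolar
  rw [coeff_sum, coeff_zero] at hcoeff
  rw [Finset.sum_eq_single k] at hcoeff
  · rw [coeff_smul, coeff_pderiv, hγk, smul_eq_mul] at hcoeff
    have hc : coeff d₀ Φ ≠ 0 := MvPolynomial.mem_support_iff.mp hd₀
    have hcast : ((γ k + 1 : ℕ) : K) = 0 := by
      have h1 : v k * coeff d₀ Φ * ((γ k : K) + 1) = 0 := by
        rw [mul_assoc]; exact hcoeff
      rcases mul_eq_zero.mp h1 with h2 | h2
      · rcases mul_eq_zero.mp h2 with h3 | h3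
        · exact absurd h3 hvk
        · exact absurd h3 hc
      · exact_mod_cast h2
    rw [hγapp] at hcast
    exact (CharP.cast_eq_zero_iff K p _).mp hcast
  · intro i _ hik
    rw [coeff_smul, coeff_pderiv, smul_eq_mul]
    have hnot : γ + Finsupp.single i 1 ∉ Φ.support := by
      intro hmem
      have hle := hmin _ hmem
      have happ : (γ + Finsupp.single i 1 : σ →₀ ℕ) k = γ k := by
        rw [Finsupp.add_apply, Finsupp.single_apply, if_neg hik, add_zero]
      rw [happ] at hle
      omega
    rw [MvPolynomial.notMem_support_iff.mp hnot, zero_mul, mul_zero]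
  · intro hk; exact absurd (Finset.mem_univ k) hk

omit [DecidableEq K] in
/-- **[OURS · L1 W4.6] At order exactly `p`, a cleaned residual polynomial divisible by `y_k` is not
additive along any direction `v` with `v_k ≠ 0`.**  (`F` cleaned, `ord₀ F = p`, `y_k ∣ F`
monomialwise — e.g. `r_k ≥ 1` with `y^r ∣ F` — and `F_p` additive along `v` with `v_k ≠ 0` is
contradictory: by `dvd_apply_of_polar_eq_zero` the least `y_k`-exponent among the degree-`p`
monomials is divisible by `p`, so that monomial is `y_k^p`, excluded by the cleaning.)
NOT a statement of the manuscript. [folklore] -/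
theorem not_additiveAlong_of_dvd (s : State σ K) (hclean : deletePthPowers p s.F = s.F)
    (hord : ordZero s.F = p) {k : σ} (hk : ∀ d ∈ s.F.support, 1 ≤ d k) {v : σ → K}
    (hvk : v k ≠ 0) (hadd : AdditiveAlong (initialForm s.F) v) : False := by
  classical
  -- the initial form is the degree-`p` component, homogeneous of degree `p`
  have hΦdef : initialForm s.F = homogeneousComponent p s.F := by
    show homogeneousComponent (ordZero s.F).toNat s.F = _
    rw [hord, ENat.toNat_coe]
  have hΦ : (initialForm s.F).IsHomogeneous p := by
    rw [hΦdef]; exact homogeneousComponent_isHomogeneous p s.F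
  -- the polar vanishes
  have hpolar : ∑ i, v i • pderiv i (initialForm s.F) = 0 := by
    have hmem := (mem_additiveSubspace_iff p hΦ v).mpr hadd
    unfold additiveSubspace at hmem
    rw [LinearMap.mem_ker] at hmem
    unfold polarMap at hmem
    rw [Fintype.linearCombination_apply] at hmem
    exact hmem
  -- support of the initial form: degree-`p` monomials of `F`
  have hsupp : ∀ d ∈ (initialForm s.F).support, d ∈ s.F.support ∧ d.degree = p := by
    intro d hd
    rw [hΦdef, MvPolynomial.mem_support_iff, coeff_homogeneousComponent] at hd
    by_cases hdeg : d.degree = p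
    · rw [if_pos hdeg] at hd
      exact ⟨MvPolynomial.mem_support_iff.mpr hd, hdeg⟩
    · rw [if_neg hdeg] at hd
      exact absurd rfl hd
  -- it is non-empty
  have hne : (initialForm s.F).support.Nonempty := by
    obtain ⟨⟨d, hd, hddeg⟩, -⟩ := (ordZero_eq_nat_iff _ _).mp hord
    refine ⟨d, ?_⟩
    rw [hΦdef, MvPolynomial.mem_support_iff, coeff_homogeneousComponent, if_pos hddeg]
    exact hd
  -- a monomial of least `y_k`-exponent
  obtain ⟨d₀, hd₀, hmin⟩ := Finset.exists_min_image (initialForm s.F).support (fun d => d k) hne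
  obtain ⟨hd₀F, hd₀deg⟩ := hsupp d₀ hd₀
  have hpos : 1 ≤ d₀ k := hk d₀ hd₀F
  have hdvd : p ∣ d₀ k := dvd_apply_of_polar_eq_zero p hvk hpolar hd₀ hmin hpos
  -- so `d₀ k = p` and `d₀ = p • e_k`
  have hdegsum : d₀.degree = ∑ i, d₀ i := Finsupp.degree_eq_sum d₀
  have hle : d₀ k ≤ d₀.degree := by
    rw [hdegsum]
    exact Finset.single_le_sum (f := fun i => d₀ i) (fun i _ => Nat.zero_le (d₀ i))
      (Finset.mem_univ k)
  rw [hd₀deg] at hle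
  have hkp : d₀ k = p := by
    obtain ⟨c, hc⟩ := hdvd
    have hc1 : c = 1 := by
      rcases Nat.lt_or_ge c 1 with h | h
      · rw [show c = 0 by omega, mul_zero] at hc; omega
      · by_contra h2
        have : p * 2 ≤ p * c := Nat.mul_le_mul_left p (by omega); omega
    rw [hc, hc1, mul_one]
  have hPth : IsPthPowerExponent p d₀ := by
    rw [isPthPowerExponent_iff]
    intro i
    by_cases hik : i = k
    · rw [hik, hkp]
    · -- all other exponents vanish: `|d₀| = p = d₀ k`
      have hsum : d₀.degree = d₀ k + ∑ l ∈ (Finset.univ : Finset σ).erase k, d₀ l := by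
        rw [hdegsum]
        exact (Finset.add_sum_erase Finset.univ (fun l => d₀ l) (Finset.mem_univ k)).symm
      have hzero : ∑ l ∈ (Finset.univ : Finset σ).erase k, d₀ l = 0 := by
        rw [hd₀deg, hkp] at hsum; omega
      have hi0 : d₀ i = 0 := by
        have hmem : i ∈ (Finset.univ : Finset σ).erase k :=
          Finset.mem_erase.mpr ⟨hik, Finset.mem_univ i⟩
        have := Finset.single_le_sum (f := fun l => d₀ l) (fun l _ => Nat.zero_le (d₀ l)) hmem
        rw [hzero] at this
        exact Nat.le_zero.mp this
      rw [hi0]; exact dvd_zero p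
  exact not_isPthPowerExponent_of_clean p hclean hd₀F hPth

/-! ## 2. No exceptional component is lost at order `p` -/

/-- **[OURS · L1 W4.6] No lost component at order `p`.**  For a cleaned state of order EXACTLY `p`
with `y^r ∣ F`, at an equimultiple point `b` of the `y_j`-chart: `r_j = 0`, and `r_i = 0` for every
translated index (`b_i ≠ 0`) — the point lies on the strict transform of every exceptional component of
positive multiplicity, and `{y_j = 0}` had multiplicity `0`.  Replaces, for the classical pair, the role
of the "no new wild data inside the window" clause of regime (iii) of RESCUE-SEED W4.6; NOT a statement
of the manuscript. [folklore] -/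
theorem no_lost_component_of_ordZero_eq (j : σ) (b : σ → K) (hbj : b j = 0) (s : State σ K)
    (hclean : deletePthPowers p s.F = s.F) (hord : ordZero s.F = p)
    (hr : ∀ d ∈ s.F.support, s.r ≤ d) (heq : IsEquimultiplePoint p j b s) :
    s.r j = 0 ∧ ∀ i, b i ≠ 0 → s.r i = 0 := by
  have hdir : OnDirectrix s (direction j b) := nearOnDirectrixAt p j b hbj s hord heq
  unfold OnDirectrix at hdir
  have key : ∀ k, direction j b k ≠ 0 → s.r k = 0 := by
    intro k hvk
    by_contra hrk
    refine not_additiveAlong_of_dvd p s hclean hord (k := k) (fun d hd => ?_) hvk hdir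
    have := hr d hd k
    have hrk1 : 1 ≤ s.r k := Nat.one_le_iff_ne_zero.mpr hrk
    exact le_trans hrk1 this
  refine ⟨key j (by rw [direction, Function.update_self]; exact one_ne_zero), fun i hbi => ?_⟩
  by_cases hij : i = j
  · subst hij; exact absurd hbj hbi
  · exact key i (by rw [direction, Function.update_of_ne hij]; exact hbi)


omit [DecidableEq K] [Fintype σ] hp in
/-- **[OURS · L1 W4.6] A cleaned residual polynomial of order `p` is tangent-informative:** its
initial form has a non-zero partial derivative (`∇F_p ≠ 0`), because a monomial with an exponent
prime to `p` survives `∂`.  NOT a statement of the manuscript. [folklore] -/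
theorem gradSpan_initialForm_ne_bot (s : State σ K) (hclean : deletePthPowers p s.F = s.F)
    (hord : ordZero s.F = p) : gradSpan (initialForm s.F) ≠ ⊥ := by
  classical
  have hΦdef : initialForm s.F = homogeneousComponent p s.F := by
    show homogeneousComponent (ordZero s.F).toNat s.F = _
    rw [hord, ENat.toNat_coe]
  obtain ⟨⟨d₀, hd₀, hd₀deg⟩, -⟩ := (ordZero_eq_nat_iff _ _).mp hord
  have hd₀F : d₀ ∈ s.F.support := MvPolynomial.mem_support_iff.mpr hd₀
  have hnot := not_isPthPowerExponent_of_clean p hclean hd₀F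
  rw [isPthPowerExponent_iff, not_forall] at hnot
  obtain ⟨i, hi⟩ := hnot
  have hpos : 1 ≤ d₀ i := Nat.one_le_iff_ne_zero.mpr fun h => hi (h ▸ dvd_zero p)
  -- `∂_i F_p` has the monomial `y^{d₀ - e_i}`
  have hne : pderiv i (initialForm s.F) ≠ 0 := by
    intro h0
    have hc := congrArg (coeff (d₀ - Finsupp.single i 1)) h0
    rw [coeff_pderiv, coeff_zero,
      tsub_add_cancel_of_le (Finsupp.single_le_iff.mpr (by simpa using hpos)), hΦdef,
      coeff_homogeneousComponent, if_pos hd₀deg] at hc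
    rcases mul_eq_zero.mp hc with h1 | h1
    · exact hd₀ h1
    · have happ : (d₀ - Finsupp.single i 1 : σ →₀ ℕ) i + 1 = d₀ i := by
        have := congrArg (fun f => f i)
          (tsub_add_cancel_of_le (Finsupp.single_le_iff.mpr (by simpa using hpos)) :
            d₀ - Finsupp.single i 1 + Finsupp.single i 1 = d₀)
        simpa using this
      have hcast : ((((d₀ - Finsupp.single i 1 : σ →₀ ℕ) i + 1 : ℕ)) : K) = 0 := by
        exact_mod_cast h1
      rw [happ] at hcast
      exact hi ((CharP.cast_eq_zero_iff K p _).mp hcast)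
  intro hbot
  have hmem : pderiv i (initialForm s.F) ∈ gradSpan (initialForm s.F) :=
    Submodule.subset_span ⟨i, rfl⟩
  rw [hbot, Submodule.mem_bot] at hmem
  exact hne hmem

/-- **[OURS · L1 W4.6] At order exactly `p` the shade is FROZEN at equimultiple points:**
`(step p j b s).shade = s.shade` (a stall — neither a drop nor an increase), because the cleaned
transform has order `p` again (tree: `PointBlowup.ordZero_step_eq_of_isEquimultiplePoint`, [CJS 2020]
Thm. 3.10 (4) in the model) and no exceptional component is lost (`no_lost_component_of_ordZero_eq`).
The classical counterpart, for the window's bottom edge, of the cusp-string stall recorded by kill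
test K4.6 (cell res-hironaka, `L/res-L0-k46/KILL-TEST-K4.6.md` §4); inside the window the shade can
move only at the steps with `p < ord₀ F < 2p`, and then only down.  NOT a statement of the
manuscript. [folklore] -/
theorem shadeStalls_of_ordZero_eq (j : σ) (b : σ → K) (hbj : b j = 0) (s : State σ K)
    (hclean : deletePthPowers p s.F = s.F) (hord : ordZero s.F = p)
    (hr : ∀ d ∈ s.F.support, s.r ≤ d) (heq : IsEquimultiplePoint p j b s) :
    ShadeStalls p j b s := by
  obtain ⟨hrj, hri⟩ := no_lost_component_of_ordZero_eq p j b hbj s hclean hord hr heq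
  have hord' : ordZero (step p j b s).F = p :=
    ordZero_step_eq_of_isEquimultiplePoint p j b hbj s hord
      (gradSpan_initialForm_ne_bot p s hclean hord) heq
  -- the new multiplicities have the same total degree
  have hmult : (step p j b s).r = s.r := by
    show newMult p j b s = s.r
    unfold newMult
    rw [hord, ENat.toNat_coe, Nat.sub_self]
    have hfilter : (s.r.filter fun i => b i = 0) = s.r := by
      rw [Finsupp.filter_eq_self_iff]
      intro i hi
      by_contra hb
      exact hi (hri i hb)
    rw [hfilter, ← hrj, Finsupp.update_self]
  unfold ShadeStalls State.shade
  rw [hord', hmult, hord]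

/-! ## 3. The window theorem -/

/-- **[OURS · L1 W4.6] Rung (iii), Moh window, one blow-up: no increase of the shade.**  For a cleaned
state `(F, r)` of `x^p + F(y)` with `y^r ∣ F` and order `o = ord₀ F` in the window `p ≤ o < 2p`, at
every EQUIMULTIPLE point `b` of every chart `y_j` (`b_j = 0`) of the blow-up of the origin the shade
does not increase: `¬ ShadeIncreases p j b s`.  Every field of characteristic `p`, every number of
variables.  Replaces the role of Th. 16.6 (2) / Eq. (127) (p. 84 l. 10–20) in regime (iii) of
RESCUE-SEED W4.6 for the classical pair (order, shade); NOT a statement of the manuscript. [folklore] -/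
theorem not_shadeIncreases_of_lt_two_mul (j : σ) (b : σ → K) (hbj : b j = 0) (s : State σ K)
    (hclean : deletePthPowers p s.F = s.F) {o : ℕ} (ho : ordZero s.F = o) (hpo : p ≤ o)
    (ho2 : o < 2 * p) (hr : ∀ d ∈ s.F.support, s.r ≤ d) (heq : IsEquimultiplePoint p j b s) :
    ¬ ShadeIncreases p j b s := by
  intro hinc
  obtain ⟨hdvd, -, i, hij, hbi, hri, -⟩ :=
    necessary_of_shadeIncreases p j b hbj s hclean ho hpo hr hinc
  -- inside the window `p ∣ o` forces `o = p`
  have hop : o = p := by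
    obtain ⟨c, hc⟩ := hdvd
    have hc1 : c = 1 := by
      rcases Nat.lt_or_ge c 1 with h | h
      · rw [show c = 0 by omega, mul_zero] at hc; omega
      · by_contra h2
        have : p * 2 ≤ p * c := Nat.mul_le_mul_left p (by omega); omega
    rw [hc, hc1, mul_one]
  rw [hop] at ho
  exact hri ((no_lost_component_of_ordZero_eq p j b hbj s hclean ho hr heq).2 i hbi)

/-- **[OURS · L1 W4.6] The same, as an inequality:** `shade' ≤ shade` inside the window at an
equimultiple point. NOT a statement of the manuscript. [folklore] -/
theorem shade_step_le_of_lt_two_mul (j : σ) (b : σ → K) (hbj : b j = 0) (s : State σ K)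
    (hclean : deletePthPowers p s.F = s.F) {o : ℕ} (ho : ordZero s.F = o) (hpo : p ≤ o)
    (ho2 : o < 2 * p) (hr : ∀ d ∈ s.F.support, s.r ≤ d) (heq : IsEquimultiplePoint p j b s) :
    (step p j b s).shade ≤ s.shade :=
  not_lt.mp (not_shadeIncreases_of_lt_two_mul p j b hbj s hclean ho hpo ho2 hr heq)

/-- **[OURS · L1 W4.6] Window version with the order as an `ℕ∞` hypothesis** (`p ≤ ord₀ F < 2p`,
no named natural number). NOT a statement of the manuscript. [folklore] -/
theorem shade_step_le_of_window (j : σ) (b : σ → K) (hbj : b j = 0) (s : State σ K)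
    (hclean : deletePthPowers p s.F = s.F) (hlo : (p : ℕ∞) ≤ ordZero s.F)
    (hhi : ordZero s.F < (2 * p : ℕ)) (hr : ∀ d ∈ s.F.support, s.r ≤ d)
    (heq : IsEquimultiplePoint p j b s) : (step p j b s).shade ≤ s.shade := by
  have hne : ordZero s.F ≠ ⊤ := ne_top_of_lt hhi
  obtain ⟨o, ho'⟩ := WithTop.ne_top_iff_exists.mp hne
  have ho : ordZero s.F = o := ho'.symm
  have hpo : p ≤ o := by rw [ho] at hlo; exact_mod_cast hlo
  have ho2 : o < 2 * p := by rw [ho] at hhi; exact_mod_cast hhi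
  exact shade_step_le_of_lt_two_mul p j b hbj s hclean ho hpo ho2 hr heq

/-! ## 4. Along a sequence of equimultiple point blow-ups inside the window -/

/-- **[OURS · L1 W4.6] Rung (iii) along a sequence.**  Let `s₀, s₁, …` be the states of a sequence of
point blow-ups `s_{n+1} = step p (j n) (b n) (s n)` at points of the successive exceptional divisors
(`b n (j n) = 0`), each EQUIMULTIPLE, starting from a cleaned state with `F ≠ 0` and `y^r ∣ F`, and
suppose the walk stays in the window: `ord₀ F_n < 2p` for all `n < N`.  Then the shade is
non-increasing up to `N`: `shade(s_m) ≤ shade(s_n)` for `n ≤ m ≤ N`.  (Equimultiplicity gives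
`p ≤ ord₀ F_n` automatically, tree `le_ordZero_step_of_isEquimultiplePoint`.)  Replaces the role of the
termination clause of Th. 16.6 in regime (iii) of RESCUE-SEED W4.6 for the classical pair; NOT a
statement of the manuscript. [folklore] -/
theorem shade_antitone_along_of_window (s : ℕ → State σ K) (j : ℕ → σ) (b : ℕ → σ → K)
    (hb : ∀ n, b n (j n) = 0) (hstep : ∀ n, s (n + 1) = step p (j n) (b n) (s n))
    (hclean : deletePthPowers p (s 0).F = (s 0).F) (hr : ∀ d ∈ (s 0).F.support, (s 0).r ≤ d)
    (hord0 : (p : ℕ∞) ≤ ordZero (s 0).F) (heq : ∀ n, IsEquimultiplePoint p (j n) (b n) (s n))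
    {N : ℕ} (hwin : ∀ n, n < N → ordZero (s n).F < (2 * p : ℕ)) {n m : ℕ} (hnm : n ≤ m)
    (hmN : m ≤ N) : (s m).shade ≤ (s n).shade := by
  -- invariants: cleaned, `y^r ∣ F`, order `≥ p`
  have hinv : ∀ n, deletePthPowers p (s n).F = (s n).F ∧
      (∀ d ∈ (s n).F.support, (s n).r ≤ d) ∧ (p : ℕ∞) ≤ ordZero (s n).F := by
    intro n
    induction n with
    | zero => exact ⟨hclean, hr, hord0⟩
    | succ n ih =>
      obtain ⟨ih1, ih2, ih3⟩ := ih
      by_cases htop : ordZero (s n).F = ⊤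
      · -- `F_n = 0`: the step of the zero polynomial is zero, every invariant holds trivially
        have hF0 : (s n).F = 0 := by
          unfold ordZero at htop
          rwa [MvPowerSeries.order_eq_top_iff, MvPolynomial.coe_eq_zero_iff] at htop
        rw [hstep n]
        refine ⟨deletePthPowers_step p (j n) (b n) (s n), ?_,
          le_ordZero_step_of_isEquimultiplePoint p (j n) (b n) (s n) (heq n)⟩
        intro d hd
        exfalso
        have : (step p (j n) (b n) (s n)).F = 0 := by
          show deletePthPowers p (pointTransform p (j n) (b n) (s n)) = 0
          unfold pointTransform chartTransform translate
          rw [hF0]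
          simp [deletePthPowers]
        rw [this, MvPolynomial.support_zero] at hd
        exact absurd hd (Finset.notMem_empty d)
      · obtain ⟨o, ho'⟩ := WithTop.ne_top_iff_exists.mp htop
        have ho : ordZero (s n).F = o := ho'.symm
        rw [hstep n]
        exact ⟨deletePthPowers_step p (j n) (b n) (s n),
          newMult_le_of_mem_support_step p (j n) (b n) (hb n) (s n) ho ih2,
          le_ordZero_step_of_isEquimultiplePoint p (j n) (b n) (s n) (heq n)⟩
  -- one step inside the window
  have hone : ∀ n, n < N → (s (n + 1)).shade ≤ (s n).shade := by
    intro n hn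
    obtain ⟨h1, h2, h3⟩ := hinv n
    rw [hstep n]
    exact shade_step_le_of_window p (j n) (b n) (hb n) (s n) h1 h3 (hwin n hn) h2 (heq n)
  -- chain
  obtain ⟨k, rfl⟩ := Nat.exists_eq_add_of_le hnm
  clear hnm
  induction k with
  | zero => exact le_rfl
  | succ k ih =>
    have hk : n + k < N := by omega
    have := hone (n + k) hk
    rw [show n + (k + 1) = n + k + 1 by omega]
    exact le_trans this (ih (by omega))

end Summit.ResolutionOfSingularities.ResolutionOfSingularities.Theorems.CampaignW46.MohWindowShade
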